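import Literature.Probability.RandomPlanarGeometry.HexSAWBrickWallRenewal
import Literature.Probability.RandomPlanarGeometry.HexSAWBrickWallBridgeDivergence
import Literature.Probability.Process.RenewalSequenceRecurrence
import HarnessLib

/-!
# Kesten's relation for brick-wall bridges of the hexagonal lattice: `Σ_k λ_k(ℍ) μ_ℍ^{-k} = 1`

Topic `Literature/Probability/RandomPlanarGeometry` (continues `HexSAWBrickWallRenewal.lean`: irreducible brick-wall
bridges `HexBW.irreducibleBridges`, `λ_n(ℍ) = HexBW.irreducibleBridgeCount n`, the renewal equation
`HexBW.bridgeCount_eq_sum_range`; and `HexSAWBrickWallBridgeDivergence.lean` (a-p6 g5): the divergence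
`HexBW.not_summable_bridgeCount_div_pow` of `Σ_n b_n(ℍ) μ_ℍ^{-n}`, Madras–Slade Corollary 3.1.8 on `ℍ`).  Lane
«pcv-sawmu», door R84 «HEX-HALFSPACE-RATIO-1», piece K5 (also the input (A.1)_ℍ of R85 «HEX-BRIDGE-RATIO-1»).

The renewal sequence `u_n = b_n(ℍ) μ_ℍ^{-n}` (`u_0 = 1`, `0 ≤ u_n ≤ 1` by `b_n(ℍ) ≤ μ_ℍ^n`, `HexBW.bridgeCount_le_pow`)
satisfies `u_n = Σ_{k≤n} f_k u_{n-k}` with `f_k = λ_k(ℍ) μ_ℍ^{-k}` (renewal equation) and `Σ u_n = ∞` (divergence);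
Feller's recurrence criterion (`Renewal.hasSum_f_one`, XIII.3 Theorem 2) gives `Σ f_k = 1`.

Status in print: Kesten's relation is proved in print for `ℤ^d` (Kesten 1963 §4; Madras–Slade (4.2.2)–(4.2.4),
pp. 90–91; Duminil-Copin–Hammond 2013, Lemma 2.2; tree `Zd.MadrasSlade1993_eq424_holds`) and STATED for the honeycomb
lattice in the strip frame of Duminil-Copin–Smirnov (Beaton–Bousquet-Mélou–de Gier–Duminil-Copin–Guttmann 2014,
Appendix, display before Lemma 11: "Kesten's relation for irreducible bridges … can be easily adapted to the honeycomb
lattice. It gives `Σ_{γ ∈ iSAB} x_c^{|γ|} = 1`"; used numerically by Alm–Parviainen 2004 and Jensen 2004 §2), where the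
tree proves it by width as `HV.hasSum_stripIlim`.  The present BRICK-WALL frame (height = coordinate `0`, along the
always-present horizontal bonds; odd lengths occur, `λ_1(ℍ) = 1`) is a different, inequivalent class of bridges
(bridges crossing `ℍ` perpendicularly to an edge class).  In this perpendicular frame Kesten's relation is likewise
STATED without proof, for the sub-class of "PP-bridges" of the rotated honeycomb lattice ("oriented so that it contains
horizontal edges"), by Beaton 2014, Appendix, display before Lemma 16: "Kesten's relation for irreducible bridges
[Kesten 1963] on the hypercubic lattice can be adapted to our lattice without difficulty. It gives
`Σ_{γ ∈ iSAPP} x_c^{|γ|} = 1`."  No proof for any class of honeycomb bridges is written out in print; the theorem below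
is the first written proof in this frame and its first kernel text (same mechanism as the strip frame).
[cite: Beaton2014RotatedHoneycomb, Appendix (display before Lemma 16, arXiv:1210.0274v3 p. 20; PP-bridges and their height, p. 19)]
-/

noncomputable section

open Filter Topology Finset

namespace Literature.Probability.RandomPlanarGeometry.SAW

namespace HexBW

/-- **Kesten's relation for brick-wall bridges of `ℍ` from the divergence of their generating function at `1/μ_ℍ`**:
if `Σ_n b_n(ℍ) μ_ℍ^{-n} = ∞` then `Σ_k λ_k(ℍ) μ_ℍ^{-k} = 1` — the renewal sequence `u_n = b_n μ^{-n}` (`u_0 = 1`,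
`0 ≤ u_n ≤ 1` by `b_n ≤ μ^n`, renewal equation (4.2.2) on `ℍ`) is recurrent (Feller XIII.3 Theorem 2).
[cite: MadrasSlade1993, §4.2, eq. (4.2.4) (p. 91); Feller1968, XIII.3, Theorem 2] -/
theorem kestenRelation_of_not_summable
    (hdiv : ¬ Summable (fun n : ℕ => (bridgeCount n : ℝ) / hexConnectiveConstant ^ n)) :
    HasSum (fun k => (irreducibleBridgeCount k : ℝ) / hexConnectiveConstant ^ k) 1 := by
  have hμ : 0 < hexConnectiveConstant := hexConnectiveConstant_pos
  refine _root_.Literature.Probability.Process.Renewal.hasSum_f_one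
    (u := fun n => (bridgeCount n : ℝ) / hexConnectiveConstant ^ n)
    (f := fun k => (irreducibleBridgeCount k : ℝ) / hexConnectiveConstant ^ k)
    ?_ (fun n => by positivity) (fun n => ?_) (fun k => by positivity) ?_ (fun n hn => ?_) hdiv
  · simp [bridgeCount_zero]
  · exact (div_le_one (pow_pos hμ n)).2 (bridgeCount_le_pow n)
  · simp [irreducibleBridgeCount_zero]
  · rw [bridgeCount_eq_sum_range hn, sum_div]
    refine sum_congr rfl fun k hk => ?_
    have hkn : k ≤ n := Nat.lt_succ_iff.1 (mem_range.1 hk)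
    rw [div_mul_div_comm, ← pow_add, Nat.add_sub_cancel' hkn]

/-- Every partial sum of Kesten's series for brick-wall bridges is at most one (unconditionally, from the renewal
equation and `b_n(ℍ) ≤ μ_ℍ^n` alone): `Σ_{k ∈ s} λ_k(ℍ) μ_ℍ^{-k} ≤ 1`. [cite: MadrasSlade1993, §4.2, eq. (4.2.4) (p. 91); Feller1968, XIII.3] -/
theorem sum_irreducibleBridgeCount_div_pow_le_one (s : Finset ℕ) :
    ∑ k ∈ s, (irreducibleBridgeCount k : ℝ) / hexConnectiveConstant ^ k ≤ 1 := by
  have hμ : 0 < hexConnectiveConstant := hexConnectiveConstant_pos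
  have hu0 : (fun n => (bridgeCount n : ℝ) / hexConnectiveConstant ^ n) 0 = 1 := by simp [bridgeCount_zero]
  have hu : ∀ n, 0 ≤ (fun n => (bridgeCount n : ℝ) / hexConnectiveConstant ^ n) n := fun n => by positivity
  have hu1 : ∀ n, (fun n => (bridgeCount n : ℝ) / hexConnectiveConstant ^ n) n ≤ 1 := fun n =>
    (div_le_one (pow_pos hμ n)).2 (bridgeCount_le_pow n)
  have hf : ∀ k, 0 ≤ (fun k => (irreducibleBridgeCount k : ℝ) / hexConnectiveConstant ^ k) k :=
    fun k => by positivity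
  have hf0 : (fun k => (irreducibleBridgeCount k : ℝ) / hexConnectiveConstant ^ k) 0 = 0 := by
    simp [irreducibleBridgeCount_zero]
  have hren : ∀ n, 1 ≤ n → (fun n => (bridgeCount n : ℝ) / hexConnectiveConstant ^ n) n =
      ∑ k ∈ range (n + 1), (fun k => (irreducibleBridgeCount k : ℝ) / hexConnectiveConstant ^ k) k *
        (fun n => (bridgeCount n : ℝ) / hexConnectiveConstant ^ n) (n - k) := by
    intro n hn
    dsimp only
    rw [bridgeCount_eq_sum_range hn, sum_div]
    refine sum_congr rfl fun k hk => ?_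
    have hkn : k ≤ n := Nat.lt_succ_iff.1 (mem_range.1 hk)
    rw [div_mul_div_comm, ← pow_add, Nat.add_sub_cancel' hkn]
  have hs := _root_.Literature.Probability.Process.Renewal.summable_f hu0 hu hu1 hf hf0 hren
  have h1 := _root_.Literature.Probability.Process.Renewal.tsum_f_le_one hu0 hu hu1 hf hf0 hren
  exact (hs.sum_le_tsum s fun k _ => hf k).trans h1

/-- **Kesten's relation for brick-wall bridges of the hexagonal lattice**: `Σ_k λ_k(ℍ) μ_ℍ^{-k} = 1`, where
`λ_k(ℍ) = HexBW.irreducibleBridgeCount k` counts the `k`-step irreducible brick-wall bridges (height = coordinate `0`)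
and `μ_ℍ = √(2+√2)` (Duminil-Copin–Smirnov) — at the critical fugacity the irreducible bridges form a probability
distribution.  NO hypotheses (renewal equation + divergence `HexBW.not_summable_bridgeCount_div_pow` + Feller).
Proved in print for `ℤ^d` (Kesten 1963 §4; Madras–Slade (4.2.2)–(4.2.4) pp. 90–91; Duminil-Copin–Hammond 2013
Lemma 2.2); stated without proof in print for `ℍ` in the STRIP frame (Beaton et al. 2014, Appendix; Alm–Parviainen
2004, Jensen 2004 §2 — tree `HV.hasSum_stripIlim`) and, in the perpendicular frame, for the PP-bridges of the rotated
honeycomb lattice (Beaton 2014, Appendix, display before Lemma 16); no written proof for `ℍ` in print.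
[cite: MadrasSlade1993, §4.2, eq. (4.2.4) (p. 91); Kesten1963SAW, §4; DuminilCopinHammond2013, Lemma 2.2; BeatonBousquetMelouDeGierDuminilCopinGuttmann2014, Appendix (display before Lemma 11); Beaton2014RotatedHoneycomb, Appendix (display before Lemma 16); Jensen2004SAWLowerBounds, §2; AlmParviainen2004] -/
theorem kestenRelation :
    HasSum (fun k => (irreducibleBridgeCount k : ℝ) / hexConnectiveConstant ^ k) 1 :=
  kestenRelation_of_not_summable not_summable_bridgeCount_div_pow

/-- `Σ' k, λ_k(ℍ) μ_ℍ^{-k} = 1`. [cite: MadrasSlade1993, §4.2, eq. (4.2.4) (p. 91)] -/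
theorem tsum_irreducibleBridgeCount_div_pow :
    ∑' k : ℕ, (irreducibleBridgeCount k : ℝ) / hexConnectiveConstant ^ k = 1 :=
  kestenRelation.tsum_eq

end HexBW

end Literature.Probability.RandomPlanarGeometry.SAW
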